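import Literature.MathematicalPhysics.QuantumFieldTheory.Balaban1983to89.B8SectEStatements
import Literature.MathematicalPhysics.QuantumFieldTheory.Balaban1983to89.B8Prop5Repaired

/-!
# `Balaban1983to89.B8Claim97OntoProof` — T. Bałaban, *Spaces of regular gauge field configurations on a lattice and
# gauge fixing conditions*, Commun. Math. Phys. **99** (1985) 75–102 [Balaban1985RegularSpaces]: the p. 97 "onto"
# sentence for the CONSTRUCTED linearizing map (1.113) (Phase-2 seat p06, SKELETON row `B8.Claim@97`)

statement-level skeleton of published theorems with citation tags; proofs where landed; nothing here is a claim
about the Yang–Mills mass gap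

PDF held: `paper:balaban1985-cmp99-regular-spaces-gauge-fixing` (journal page = PDF page + 74); pages read for this
file: p. 94 [PDF 20] (Proposition 5, (1.109) and the sentence after it), p. 95 [PDF 21] ((1.113)), pp. 96–97
[PDF 22–23] ((1.117)–(1.125) and the last paragraph of Sect. E).

CITATION HEADER / WHAT IS REPRODUCED.  SKELETON row `B8.Claim@97` (HOME/lit-balaban-r05/ROWS-B8.md), the sentence
printed WITHOUT proof at the end of Sect. E, p. 97: *"They imply in particular that the mapping (1.113) transforms
the set {λ: |λ| < ½α₄, |Dλ| < ½α₄(Lʲη)⁻¹ on Ω_j} onto a set containing {λ′: |λ′| < ¼α₄, |Dλ′| < ¼α₄(Lʲη)⁻¹ on Ω_j}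
for α₃, α₄ sufficiently small."*  It is the input of the uniqueness clause (1.109) of Proposition 5 (p. 94: *"The
uniqueness follows from the fact that the image of a set {λ: |λ|, |Dλ|₍₋₁₎ < ½α₄} by the transformation
λ → λ − H′D′(u₁, λ) contains the set {λ′: |λ′|, |Dλ′|₍₋₁₎ < ¼α₄} for α₄ sufficiently small. This follows from
results of the next section."*), hence of "exactly one" in Theorems 2, 4, 8.

KNITTING (PHASE2-TARGETS §G.2 (b), seat p06 = this file).  The tree had the sentence only ABSTRACTLY, for an
arbitrary map `F` assumed ½-Lipschitz and small (`B8SectE.onto_of_lipschitz_half`, `B8Prop5Repaired.onto_half_ball`),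
and separately the CONSTRUCTED `D′ = B8SectEStatements.Dprime` (the solution of (1.117) in the ball
‖X‖ ≤ α₄/(2B′₀), p239571) with the linearizing map `B8SectEStatements.linMap C′ H′ ρ λ = λ − H′(D′ λ)` (1.113).
This file proves the sentence FOR THAT MAP, from the printed inputs only:
(1.121) [= (214) of [3]]: `‖C′ μ‖ < C′₂(α₃+α₄)α₄` for `‖μ‖ < α₄`; (1.125): `C′` is `2C′₂(α₃+α₄)`-Lipschitz on
`‖μ‖ < α₄`; (1.92): `‖H′‖ ≤ B′₀`; and the smallness `α₃ + α₄ ≤ 1/(8B′₀C′₂)` — print's "α₃, α₄ sufficiently small"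
made explicit (print's own contraction threshold for (1.118) is `1/(4C′₂B′₀)`, p. 97; its half makes `H′D′`
½-Lipschitz AND `‖H′D′(λ)‖ ≤ α₄/8`, the two constants the onto step needs — cf. `B8SectE.b8_sectE_smallness`).
Carrier: two real normed spaces `Λ` (λ-configurations, norm `max{|λ|, Lʲη|Dλ| on Ω_j}` so that the printed sets
are norm-balls) and `F` (X-configurations), both complete; exactly the carriers of `B8SectEStatements`.
* `Dprime_lipschitz` — the step print does not write (GAPS G-B8-05 (a)): on the open ball ‖λ‖ < ½α₄ the constructed
  `D′` is Lipschitz with constant `c/(1 − cB′₀)`, `c = 2C′₂(α₃+α₄)` (from (1.117) + (1.125) + (1.92)).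
* `HDprime_lipschitz_half`, `norm_HDprime_le` — `λ ↦ H′D′(λ)` is ½-Lipschitz and bounded by `α₄/8` on ‖λ‖ < ½α₄.
* `linMap_onto_quarter` — **the sentence**: for every `λ′` with `‖λ′‖ < ¼α₄` there is exactly one `λ` in the closed
  ball `closedBall λ′ (¼α₄)` with `linMap λ = λ′`, and every point of that ball has `‖λ‖ < ½α₄` (Banach's fixed
  point theorem for `y ↦ H′D′(λ′ + y)` on `‖y‖ ≤ ¼α₄`, via `B8SectDSource.fixedPoint_closedBall`).
* `linMap_onto_quarter'` — the same in the hypothesis shape `∀ μ, ‖μ‖ < α/4 → ∃ λ, ‖λ‖ < α/2 ∧ λ − F λ = μ` consumed by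
  `B8Prop5Repaired.unique_of_onto` / `propFive_assembled` (`Fmap := fun λ => H′ (D′ λ)`), so those assemblies can
  now be fed the constructed `D′` instead of a hypothesised map.
NOT here (and not claimed): the discharge of (1.121), (1.125), (1.92) from the lattice objects `C′` ((213)–(214)
of [3]) and `H′` ((1.91)); analyticity of `D′` in λ.

Unit `lit-balaban-r05` gen 2 (Phase-2 seat p06 taken by the nominating reader, PHASE2-TARGETS §G.5-4);
HOME `run/shared/lean/pub/lit-balaban/` (ROWS-B8.md row B8.Claim@97, FILED.md).

v1.1 (lit-balaban r05 gen 3, 2026-08-21; APPEND-ONLY, §4 below; v1 declarations untouched).  KNITTING the sentence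
into Proposition 5: the tree's abstract assembly `B8Prop5Repaired.propFive_assembled` (existence (1.107)–(1.108) at
the smallest `α₄ = 8B′₀B₁(α₀+α₁)`, uniqueness (1.109) at the largest `α₄`, p. 94) takes the Sect. E map
`F = H′D′(u₁, ·)` with its ½-Lipschitz / smallness properties as HYPOTHESES (`hFlip`, `hFsmall`, `hFmin`).  §4
discharges them for the CONSTRUCTED `D′`: `Dprime_eq_of_le` (the solution of (1.117) does not depend on the radius
of the ball it is sought in — print's D′ is "the" solution, our `Dprime` carries the radius), `propFive_constructed`
(Proposition 5, both clauses, with `F := H′ ∘ Dprime` and NO hypothesis on `F`: the onto input is v1's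
`linMap_onto_quarter'` at the largest parameter, the bound `‖H′D′λ⋆‖ ≤ B′₀B₁(α₀+α₁)` is v1's `norm_HDprime_le` at
the smallest, giving `‖μ⋆‖ ≤ 3B′₀B₁(α₀+α₁) < 8B′₀B₁(α₀+α₁)` = (1.108)), `propFive_constructed_printed_shape`
((1.107)–(1.109) in the printed shape: a solution below `8B′₀B₁(α₀+α₁)`, exactly one below `c₃ = ¼α₄`).  Inputs
left, all printed displays carried as named hypotheses over the abstract carriers: ‖G′‖ ≤ B′₀ ((1.101), [4] Thm
3.1), ‖RD*A‖ ≤ B₁(α₀+α₁), the repaired (1.99) (census G-B8-11/12, as in `B8Prop5Repaired`), (1.92), (1.121),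
(1.125) at the two parameter values, `α₃ + α₄ ≤ 1/(8B′₀C′₂)`, and the Sect. C–D dictionary between fixed points of
(1.100) and solutions of (1.107).  SKELETON row B8.Prop5 stays `typed-existing` (abstract carriers); its cell note
"existence + uniqueness GIVEN … D′ …" loses the D′.
-/

noncomputable section

namespace Literature.MathematicalPhysics.QuantumFieldTheory.Balaban1983to89.B8Claim97OntoProof

open Metric
open Literature.MathematicalPhysics.QuantumFieldTheory.Balaban1983to89.B8SectEStatements (Eq1117 Dprime linMap
  Dprime_spec norm_arg_lt)

variable {Λ F : Type*} [NormedAddCommGroup Λ] [NormedSpace ℝ Λ] [NormedAddCommGroup F] [NormedSpace ℝ F]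
  [CompleteSpace F]

/-- The halved smallness `α₃ + α₄ ≤ 1/(8B′₀C′₂)` implies print's `α₃ + α₄ ≤ 1/(4C′₂B′₀)` (p. 97), under which
`B8SectEStatements.Dprime_spec` applies. [cite: Balaban1985RegularSpaces, p.97 (contraction condition for (1.118))] -/
theorem smallness_quarter_of_eighth {B₀' C₂' α₃ α₄ : ℝ} (hB : 0 < B₀') (hC : 0 < C₂')
    (hsm : α₃ + α₄ ≤ 1 / (8 * B₀' * C₂')) : α₃ + α₄ ≤ 1 / (4 * B₀' * C₂') := by
  refine hsm.trans ?_
  have h8 : 0 < 8 * B₀' * C₂' := by positivity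
  have h4 : 0 < 4 * B₀' * C₂' := by positivity
  rw [div_le_div_iff₀ h8 h4]
  nlinarith

/-- **D′ is Lipschitz on the open ball ‖λ‖ < ½α₄** — the step Sect. E does not write out (it bounds the
derivative of `C′` by (1.125) and `H′` by (1.92) but never derives a Lipschitz constant for the fixed point `D′` of
(1.118)): with `c := 2C′₂(α₃+α₄)`, `‖D′λ₁ − D′λ₂‖ ≤ c/(1 − cB′₀)·‖λ₁ − λ₂‖`.  Proof: `Xᵢ = C′(λᵢ − H′Xᵢ)` (1.117),
the arguments lie in ‖μ‖ < α₄ by (1.120), so (1.125) gives `‖X₁ − X₂‖ ≤ c(‖λ₁ − λ₂‖ + B′₀‖X₁ − X₂‖)`.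
[cite: Balaban1985RegularSpaces, (1.117)–(1.118) p.96; (1.125) p.97] -/
theorem Dprime_lipschitz (C' : Λ → F) (H' : F →L[ℝ] Λ) {B₀' C₂' α₃ α₄ : ℝ}
    (hB : 0 < B₀') (hC : 0 < C₂') (h3 : 0 ≤ α₃) (h4 : 0 < α₄) (hH : ‖H'‖ ≤ B₀')
    (h121 : ∀ μ : Λ, ‖μ‖ < α₄ → ‖C' μ‖ < C₂' * (α₃ + α₄) * α₄)
    (h125 : ∀ μ₁ μ₂ : Λ, ‖μ₁‖ < α₄ → ‖μ₂‖ < α₄ → ‖C' μ₁ - C' μ₂‖ ≤ 2 * C₂' * (α₃ + α₄) * ‖μ₁ - μ₂‖)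
    (hsm : α₃ + α₄ ≤ 1 / (8 * B₀' * C₂')) {lam₁ lam₂ : Λ} (h₁ : ‖lam₁‖ < α₄ / 2) (h₂ : ‖lam₂‖ < α₄ / 2) :
    ‖Dprime C' H' (α₄ / (2 * B₀')) lam₁ - Dprime C' H' (α₄ / (2 * B₀')) lam₂‖ ≤
      (2 * C₂' * (α₃ + α₄)) / (1 - 2 * C₂' * (α₃ + α₄) * B₀') * ‖lam₁ - lam₂‖ := by
  have hsm4 := smallness_quarter_of_eighth hB hC hsm
  set c : ℝ := 2 * C₂' * (α₃ + α₄) with hc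
  set X₁ := Dprime C' H' (α₄ / (2 * B₀')) lam₁ with hX₁
  set X₂ := Dprime C' H' (α₄ / (2 * B₀')) lam₂ with hX₂
  obtain ⟨hb₁, hs₁⟩ := Dprime_spec C' H' hB hC h3 h4 hH h121 h125 hsm4 h₁
  obtain ⟨hb₂, hs₂⟩ := Dprime_spec C' H' hB hC h3 h4 hH h121 h125 hsm4 h₂
  rw [← hX₁] at hb₁ hs₁
  rw [← hX₂] at hb₂ hs₂
  have ha₁ : ‖lam₁ - H' X₁‖ < α₄ := norm_arg_lt H' hB hH h₁ hb₁
  have ha₂ : ‖lam₂ - H' X₂‖ < α₄ := norm_arg_lt H' hB hH h₂ hb₂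
  have hc0 : 0 ≤ c := by rw [hc]; positivity
  -- cB′₀ ≤ 1/4 from the smallness
  have hcB : c * B₀' ≤ 1 / 4 := by
    have h1 : C₂' * (α₃ + α₄) * B₀' ≤ C₂' * (1 / (8 * B₀' * C₂')) * B₀' :=
      mul_le_mul_of_nonneg_right (mul_le_mul_of_nonneg_left hsm hC.le) hB.le
    have h2 : C₂' * (1 / (8 * B₀' * C₂')) * B₀' = 1 / 8 := by field_simp
    rw [hc]; nlinarith
  have hden : 0 < 1 - c * B₀' := by linarith
  -- the key estimate ‖X₁ − X₂‖ ≤ c (‖λ₁ − λ₂‖ + B′₀ ‖X₁ − X₂‖)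
  have hkey : ‖X₁ - X₂‖ ≤ c * (‖lam₁ - lam₂‖ + B₀' * ‖X₁ - X₂‖) := by
    have hX : X₁ - X₂ = C' (lam₁ - H' X₁) - C' (lam₂ - H' X₂) := by
      unfold Eq1117 at hs₁ hs₂; rw [hs₁, hs₂]
    have hdiff : (lam₁ - H' X₁) - (lam₂ - H' X₂) = (lam₁ - lam₂) - H' (X₁ - X₂) := by
      rw [map_sub]; abel
    calc ‖X₁ - X₂‖ = ‖C' (lam₁ - H' X₁) - C' (lam₂ - H' X₂)‖ := by rw [hX]
      _ ≤ c * ‖(lam₁ - H' X₁) - (lam₂ - H' X₂)‖ := h125 _ _ ha₁ ha₂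
      _ = c * ‖(lam₁ - lam₂) - H' (X₁ - X₂)‖ := by rw [hdiff]
      _ ≤ c * (‖lam₁ - lam₂‖ + ‖H' (X₁ - X₂)‖) := mul_le_mul_of_nonneg_left (norm_sub_le _ _) hc0
      _ ≤ c * (‖lam₁ - lam₂‖ + B₀' * ‖X₁ - X₂‖) := by
          refine mul_le_mul_of_nonneg_left (add_le_add le_rfl ?_) hc0
          exact (H'.le_opNorm _).trans (mul_le_mul_of_nonneg_right hH (norm_nonneg _))
  -- solve for ‖X₁ − X₂‖
  have h' : (1 - c * B₀') * ‖X₁ - X₂‖ ≤ c * ‖lam₁ - lam₂‖ := by nlinarith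
  rw [div_mul_eq_mul_div, le_div_iff₀ hden]
  linarith

/-- **`λ ↦ H′D′(λ)` is ½-Lipschitz on ‖λ‖ < ½α₄** (from `Dprime_lipschitz` and ‖H′‖ ≤ B′₀: the constant is
`B′₀c/(1 − cB′₀) ≤ (1/4)/(3/4) = 1/3 ≤ 1/2` since `cB′₀ ≤ 1/4`). [cite: Balaban1985RegularSpaces, p.97 (after (1.125));
(1.92) pp.91–92] -/
theorem HDprime_lipschitz_half (C' : Λ → F) (H' : F →L[ℝ] Λ) {B₀' C₂' α₃ α₄ : ℝ}
    (hB : 0 < B₀') (hC : 0 < C₂') (h3 : 0 ≤ α₃) (h4 : 0 < α₄) (hH : ‖H'‖ ≤ B₀')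
    (h121 : ∀ μ : Λ, ‖μ‖ < α₄ → ‖C' μ‖ < C₂' * (α₃ + α₄) * α₄)
    (h125 : ∀ μ₁ μ₂ : Λ, ‖μ₁‖ < α₄ → ‖μ₂‖ < α₄ → ‖C' μ₁ - C' μ₂‖ ≤ 2 * C₂' * (α₃ + α₄) * ‖μ₁ - μ₂‖)
    (hsm : α₃ + α₄ ≤ 1 / (8 * B₀' * C₂')) {lam₁ lam₂ : Λ} (h₁ : ‖lam₁‖ < α₄ / 2) (h₂ : ‖lam₂‖ < α₄ / 2) :
    ‖H' (Dprime C' H' (α₄ / (2 * B₀')) lam₁) - H' (Dprime C' H' (α₄ / (2 * B₀')) lam₂)‖ ≤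
      (1 / 2) * ‖lam₁ - lam₂‖ := by
  have hD := Dprime_lipschitz C' H' hB hC h3 h4 hH h121 h125 hsm h₁ h₂
  set c : ℝ := 2 * C₂' * (α₃ + α₄) with hc
  have hc0 : 0 ≤ c := by rw [hc]; positivity
  have hcB : c * B₀' ≤ 1 / 4 := by
    have h1 : C₂' * (α₃ + α₄) * B₀' ≤ C₂' * (1 / (8 * B₀' * C₂')) * B₀' :=
      mul_le_mul_of_nonneg_right (mul_le_mul_of_nonneg_left hsm hC.le) hB.le
    have h2 : C₂' * (1 / (8 * B₀' * C₂')) * B₀' = 1 / 8 := by field_simp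
    rw [hc]; nlinarith
  have hden : 0 < 1 - c * B₀' := by linarith
  have hratio : B₀' * (c / (1 - c * B₀')) ≤ 1 / 2 := by
    rw [mul_div_assoc', div_le_iff₀ hden]
    nlinarith
  calc ‖H' (Dprime C' H' (α₄ / (2 * B₀')) lam₁) - H' (Dprime C' H' (α₄ / (2 * B₀')) lam₂)‖
      = ‖H' (Dprime C' H' (α₄ / (2 * B₀')) lam₁ - Dprime C' H' (α₄ / (2 * B₀')) lam₂)‖ := by rw [map_sub]
    _ ≤ B₀' * ‖Dprime C' H' (α₄ / (2 * B₀')) lam₁ - Dprime C' H' (α₄ / (2 * B₀')) lam₂‖ :=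
        (H'.le_opNorm _).trans (mul_le_mul_of_nonneg_right hH (norm_nonneg _))
    _ ≤ B₀' * (c / (1 - c * B₀') * ‖lam₁ - lam₂‖) := mul_le_mul_of_nonneg_left hD hB.le
    _ = B₀' * (c / (1 - c * B₀')) * ‖lam₁ - lam₂‖ := by ring
    _ ≤ (1 / 2) * ‖lam₁ - lam₂‖ := mul_le_mul_of_nonneg_right hratio (norm_nonneg _)

/-- **`‖H′D′(λ)‖ ≤ α₄/8` on ‖λ‖ < ½α₄**: from the printed bound *"|D′(λ)| = |C′(λ − H′D′(λ))| < C′₂(α₃+α₄)α₄"*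
(p. 97, `B8SectEStatements.Dprime_bound`), ‖H′‖ ≤ B′₀ and `B′₀C′₂(α₃+α₄) ≤ 1/8`. [cite: Balaban1985RegularSpaces,
p.97 (bound on D′ after (1.125)); (1.92) pp.91–92] -/
theorem norm_HDprime_le (C' : Λ → F) (H' : F →L[ℝ] Λ) {B₀' C₂' α₃ α₄ : ℝ}
    (hB : 0 < B₀') (hC : 0 < C₂') (h3 : 0 ≤ α₃) (h4 : 0 < α₄) (hH : ‖H'‖ ≤ B₀')
    (h121 : ∀ μ : Λ, ‖μ‖ < α₄ → ‖C' μ‖ < C₂' * (α₃ + α₄) * α₄)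
    (h125 : ∀ μ₁ μ₂ : Λ, ‖μ₁‖ < α₄ → ‖μ₂‖ < α₄ → ‖C' μ₁ - C' μ₂‖ ≤ 2 * C₂' * (α₃ + α₄) * ‖μ₁ - μ₂‖)
    (hsm : α₃ + α₄ ≤ 1 / (8 * B₀' * C₂')) {lam : Λ} (hlam : ‖lam‖ < α₄ / 2) :
    ‖H' (Dprime C' H' (α₄ / (2 * B₀')) lam)‖ ≤ α₄ / 8 := by
  have hsm4 := smallness_quarter_of_eighth hB hC hsm
  have hDb := B8SectEStatements.Dprime_bound C' H' hB hC h3 h4 hH h121 h125 hsm4 hlam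
  have hprod : B₀' * (C₂' * (α₃ + α₄)) ≤ 1 / 8 := by
    have h1 : B₀' * (C₂' * (α₃ + α₄)) ≤ B₀' * (C₂' * (1 / (8 * B₀' * C₂'))) :=
      mul_le_mul_of_nonneg_left (mul_le_mul_of_nonneg_left hsm hC.le) hB.le
    have h2 : B₀' * (C₂' * (1 / (8 * B₀' * C₂'))) = 1 / 8 := by field_simp
    linarith
  calc ‖H' (Dprime C' H' (α₄ / (2 * B₀')) lam)‖ ≤ ‖H'‖ * ‖Dprime C' H' (α₄ / (2 * B₀')) lam‖ := H'.le_opNorm _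
    _ ≤ B₀' * (C₂' * (α₃ + α₄) * α₄) := mul_le_mul hH hDb.le (norm_nonneg _) hB.le
    _ = B₀' * (C₂' * (α₃ + α₄)) * α₄ := by ring
    _ ≤ (1 / 8) * α₄ := mul_le_mul_of_nonneg_right hprod h4.le
    _ = α₄ / 8 := by ring

variable [CompleteSpace Λ]

/-- **The p. 97 "onto" sentence for the constructed map (1.113)** (SKELETON row B8.Claim@97), verbatim: *"They imply
in particular that the mapping (1.113) transforms the set {λ: |λ| < ½α₄, |Dλ| < ½α₄(Lʲη)⁻¹ on Ω_j} onto a set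
containing {λ′: |λ′| < ¼α₄, |Dλ′| < ¼α₄(Lʲη)⁻¹ on Ω_j} for α₃, α₄ sufficiently small."* — typed reading: for every
`λ′` with `‖λ′‖ < ¼α₄` there is EXACTLY ONE `λ` in `closedBall λ′ (¼α₄)` with `linMap C′ H′ (α₄/(2B′₀)) λ = λ′`, and
every point of that ball (in particular that `λ`) has `‖λ‖ < ½α₄`; "sufficiently small" = `α₃ + α₄ ≤ 1/(8B′₀C′₂)`.
Proof: Banach's fixed point theorem for `y ↦ H′D′(λ′ + y)` on `‖y‖ ≤ ¼α₄` (self-map by `norm_HDprime_le`,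
½-contraction by `HDprime_lipschitz_half`), `λ := λ′ + y`. [cite: Balaban1985RegularSpaces, p.97 (last paragraph of
Sect. E); (1.113) p.95; (1.109) p.94] -/
theorem linMap_onto_quarter (C' : Λ → F) (H' : F →L[ℝ] Λ) {B₀' C₂' α₃ α₄ : ℝ}
    (hB : 0 < B₀') (hC : 0 < C₂') (h3 : 0 ≤ α₃) (h4 : 0 < α₄) (hH : ‖H'‖ ≤ B₀')
    (h121 : ∀ μ : Λ, ‖μ‖ < α₄ → ‖C' μ‖ < C₂' * (α₃ + α₄) * α₄)
    (h125 : ∀ μ₁ μ₂ : Λ, ‖μ₁‖ < α₄ → ‖μ₂‖ < α₄ → ‖C' μ₁ - C' μ₂‖ ≤ 2 * C₂' * (α₃ + α₄) * ‖μ₁ - μ₂‖)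
    (hsm : α₃ + α₄ ≤ 1 / (8 * B₀' * C₂')) (lam' : Λ) (hlam' : ‖lam'‖ < α₄ / 4) :
    (∃! lam : Λ, lam ∈ closedBall lam' (α₄ / 4) ∧ linMap C' H' (α₄ / (2 * B₀')) lam = lam') ∧
      ∀ lam ∈ closedBall lam' (α₄ / 4), ‖lam‖ < α₄ / 2 := by
  -- every point of the closed quarter-ball around λ′ lies in the open half-ball
  have hball : ∀ lam ∈ closedBall lam' (α₄ / 4), ‖lam‖ < α₄ / 2 := by
    intro lam hlam
    rw [mem_closedBall, dist_eq_norm] at hlam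
    calc ‖lam‖ = ‖(lam - lam') + lam'‖ := by rw [sub_add_cancel]
      _ ≤ ‖lam - lam'‖ + ‖lam'‖ := norm_add_le _ _
      _ < α₄ / 4 + α₄ / 4 := by linarith
      _ = α₄ / 2 := by ring
  have hshift : ∀ y : Λ, ‖y‖ ≤ α₄ / 4 → ‖lam' + y‖ < α₄ / 2 := by
    intro y hy
    refine hball (lam' + y) ?_
    rw [mem_closedBall, dist_eq_norm, add_sub_cancel_left]
    exact hy
  set Fm : Λ → Λ := fun lam => H' (Dprime C' H' (α₄ / (2 * B₀')) lam) with hFm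
  -- Banach on the shifted ball: g y := F(λ′ + y)
  set g : Λ → Λ := fun y => Fm (lam' + y) with hg
  have hρ : 0 ≤ α₄ / 4 := by positivity
  have hmaps : ∀ y : Λ, ‖y‖ ≤ α₄ / 4 → ‖g y‖ ≤ α₄ / 4 := by
    intro y hy
    have := norm_HDprime_le C' H' hB hC h3 h4 hH h121 h125 hsm (hshift y hy)
    simp only [hg, hFm]
    linarith
  have hlip : ∀ y z : Λ, ‖y‖ ≤ α₄ / 4 → ‖z‖ ≤ α₄ / 4 → ‖g y - g z‖ ≤ (1 / 2) * ‖y - z‖ := by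
    intro y z hy hz
    have := HDprime_lipschitz_half C' H' hB hC h3 h4 hH h121 h125 hsm (hshift y hy) (hshift z hz)
    simp only [hg, hFm]
    rwa [add_sub_add_left_eq_sub] at this
  obtain ⟨y, ⟨hyb, hyfix⟩, huniq⟩ :=
    B8SectDSource.fixedPoint_closedBall g hρ (κ := 1 / 2) (by norm_num) (by norm_num) hmaps hlip
  refine ⟨⟨lam' + y, ⟨?_, ?_⟩, ?_⟩, hball⟩
  · rw [mem_closedBall, dist_eq_norm, add_sub_cancel_left]; exact hyb
  · -- linMap (λ′ + y) = λ′ + y − F(λ′ + y) = λ′ + y − g y = λ′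
    show lam' + y - H' (Dprime C' H' (α₄ / (2 * B₀')) (lam' + y)) = lam'
    have : g y = H' (Dprime C' H' (α₄ / (2 * B₀')) (lam' + y)) := rfl
    rw [← this, hyfix]; abel
  · rintro lam ⟨hmem, hlin⟩
    -- y′ := λ − λ′ is a fixed point of g in the ball, hence y′ = y
    have hmem' : ‖lam - lam'‖ ≤ α₄ / 4 := by rwa [mem_closedBall, dist_eq_norm] at hmem
    have hfix' : g (lam - lam') = lam - lam' := by
      have hl : lam - H' (Dprime C' H' (α₄ / (2 * B₀')) lam) = lam' := hlin
      have : g (lam - lam') = H' (Dprime C' H' (α₄ / (2 * B₀')) lam) := by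
        simp only [hg, hFm, add_sub_cancel]
      rw [this]
      -- from λ − F λ = λ′:  F λ = λ − λ′
      have := congrArg (fun z => lam - z) hl
      simp only [sub_sub_cancel] at this
      exact this
    have := huniq (lam - lam') ⟨hmem', hfix'⟩
    rw [← this, add_sub_cancel]

/-- **The same sentence in the hypothesis shape of `B8Prop5Repaired.unique_of_onto` / `propFive_assembled`**
(`honto : ∀ μ, ‖μ‖ < α/4 → ∃ λ, ‖λ‖ < α/2 ∧ λ − Fmap λ = μ` with `Fmap := fun λ => H′ (D′ λ)`): those abstract
assemblies of Proposition 5 can be fed the CONSTRUCTED `D′`. [cite: Balaban1985RegularSpaces, p.97 (last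
paragraph of Sect. E); (1.109) p.94] -/
theorem linMap_onto_quarter' (C' : Λ → F) (H' : F →L[ℝ] Λ) {B₀' C₂' α₃ α₄ : ℝ}
    (hB : 0 < B₀') (hC : 0 < C₂') (h3 : 0 ≤ α₃) (h4 : 0 < α₄) (hH : ‖H'‖ ≤ B₀')
    (h121 : ∀ μ : Λ, ‖μ‖ < α₄ → ‖C' μ‖ < C₂' * (α₃ + α₄) * α₄)
    (h125 : ∀ μ₁ μ₂ : Λ, ‖μ₁‖ < α₄ → ‖μ₂‖ < α₄ → ‖C' μ₁ - C' μ₂‖ ≤ 2 * C₂' * (α₃ + α₄) * ‖μ₁ - μ₂‖)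
    (hsm : α₃ + α₄ ≤ 1 / (8 * B₀' * C₂')) :
    ∀ μ : Λ, ‖μ‖ < α₄ / 4 →
      ∃ lam : Λ, ‖lam‖ < α₄ / 2 ∧ lam - H' (Dprime C' H' (α₄ / (2 * B₀')) lam) = μ := by
  intro μ hμ
  obtain ⟨⟨lam, ⟨hmem, hlin⟩, -⟩, hball⟩ :=
    linMap_onto_quarter C' H' hB hC h3 h4 hH h121 h125 hsm μ hμ
  exact ⟨lam, hball lam hmem, hlin⟩

/-! ## §4 (v1.1) Proposition 5 assembled with the CONSTRUCTED `D′` — the p. 97 sentence knitted into (1.109)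

p. 94 [PDF 20]: *"To get a best uniqueness result we have to take a largest possible α₄. It is independent of
α₀ + α₁. To get best bounds on the solution we have to take a smallest possible α₄, hence α₄ = 8B′₀B₁(α₀+α₁)"* —
print runs Sect. D–E at TWO values of α₄ with ONE function D′ ("the" solution of (1.117)); our `Dprime` carries the
ball radius `α₄/(2B′₀)`, so the first lemma records that the two radii give the same value where both apply. -/

omit [CompleteSpace Λ] in
/-- **`D′` does not depend on the radius of the ball in which (1.117) is solved**: if the printed inputs (1.121),
(1.125) hold at two parameters `α₄′ ≤ α₄` (with (1.92) and `α₃ + α₄ ≤ 1/(4B′₀C′₂)`), then for `‖λ‖ < ½α₄′` the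
solution in the ball of radius `α₄′/(2B′₀)` is the solution in the ball of radius `α₄/(2B′₀)` ("exactly one
solution of Eq. (1.117)", p. 97, `B8SectEStatements.Dprime_unique`). [cite: Balaban1985RegularSpaces, (1.117) p.96;
p.97 (definition of D′); p.94 (the two choices of α₄)] -/
theorem Dprime_eq_of_le (C' : Λ → F) (H' : F →L[ℝ] Λ) {B₀' C₂' α₃ α₄ α₄' : ℝ}
    (hB : 0 < B₀') (hC : 0 < C₂') (h3 : 0 ≤ α₃) (h4 : 0 < α₄) (h4' : 0 < α₄') (hle : α₄' ≤ α₄)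
    (hH : ‖H'‖ ≤ B₀')
    (h121 : ∀ μ : Λ, ‖μ‖ < α₄ → ‖C' μ‖ < C₂' * (α₃ + α₄) * α₄)
    (h125 : ∀ μ₁ μ₂ : Λ, ‖μ₁‖ < α₄ → ‖μ₂‖ < α₄ → ‖C' μ₁ - C' μ₂‖ ≤ 2 * C₂' * (α₃ + α₄) * ‖μ₁ - μ₂‖)
    (hsm : α₃ + α₄ ≤ 1 / (4 * B₀' * C₂'))
    (h121' : ∀ μ : Λ, ‖μ‖ < α₄' → ‖C' μ‖ < C₂' * (α₃ + α₄') * α₄')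
    (h125' : ∀ μ₁ μ₂ : Λ, ‖μ₁‖ < α₄' → ‖μ₂‖ < α₄' → ‖C' μ₁ - C' μ₂‖ ≤ 2 * C₂' * (α₃ + α₄') * ‖μ₁ - μ₂‖)
    {lam : Λ} (hlam : ‖lam‖ < α₄' / 2) :
    Dprime C' H' (α₄ / (2 * B₀')) lam = Dprime C' H' (α₄' / (2 * B₀')) lam := by
  have hsm' : α₃ + α₄' ≤ 1 / (4 * B₀' * C₂') := by linarith
  obtain ⟨hb', hs'⟩ := Dprime_spec C' H' hB hC h3 h4' hH h121' h125' hsm' hlam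
  have hlam₄ : ‖lam‖ < α₄ / 2 := by linarith
  have hb : ‖Dprime C' H' (α₄' / (2 * B₀')) lam‖ ≤ α₄ / (2 * B₀') :=
    hb'.trans (by gcongr)
  exact (B8SectEStatements.Dprime_unique C' H' hB hC h3 h4 hH h121 h125 hsm hlam₄ hb hs').symm

section PropFiveConstructed

open B8Prop5Repaired (propFive_repaired_choice fixedPoint_of_sup_bound eq_of_existsUnique_fixedPoint
  sol_eq_image_of_onto)

variable {E Gm Xc : Type*} [NormedAddCommGroup E] [NormedSpace ℂ E] [CompleteSpace E]
  [NormedAddCommGroup Gm] [NormedSpace ℂ Gm] [NormedAddCommGroup Xc] [NormedSpace ℝ Xc] [CompleteSpace Xc]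

/-- **Proposition 5 (1.107)–(1.109) assembled with the CONSTRUCTED `D′`** — `B8Prop5Repaired.propFive_assembled`
with its three hypotheses on the Sect. E map DISCHARGED.  Carriers: `E` = λ-configurations (complex Banach; the
real structure is the restriction of scalars), `Gm` = the space of `RD*A + R𝔉₄` ((1.100), complex normed), `Xc` =
X-configurations of Sect. E (real Banach).  Inputs (named hypotheses, all printed): `‖G′‖ ≤ B′₀` ((1.101), Thm 3.1
of [4]); `‖RD*A‖ ≤ B₁s`, `s = α₀ + α₁`; the repaired (1.99) `‖Φ λ‖ ≤ C′₄(B₁s + ρ)α₄` on the domain (1.102) at the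
largest parameter `α` and at the smallest `8B′₀B₁s` (census G-B8-11/12, exactly as in `propFive_assembled`), with
`Φ` analytic; `8B′₀C′₄(B₁s + ρ) ≤ 1`; `‖H′‖ ≤ B′₀` ((1.92)); (1.121) and (1.125) at the two parameters; print's
"α₃, α₄ sufficiently small" as `α₃ + α ≤ 1/(8B′₀C′₂)`; the Sect. C–D dictionary between fixed points of (1.100) and
solutions of (1.107) for `u′ = exp[i(λ − H′D′(u₁, λ))]` (p. 94).  `F := λ ↦ H′(D′λ)` with `D′ = Dprime C′ H′ (α/(2B′₀))`.
Conclusions: a fixed point `λ⋆`, `‖λ⋆‖ ≤ 2B′₀B₁s`; `μ⋆ := λ⋆ − Fλ⋆` solves (1.107) with `‖μ⋆‖ ≤ 3B′₀B₁s`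
(< `8B′₀B₁s`, the printed (1.108)); every solution `μ` with `‖μ‖ < ¼α` equals `μ⋆` ((1.109), `c₃ = ¼α`).  The onto
input is `linMap_onto_quarter'` (largest parameter); the bound on `‖Fλ⋆‖` is `norm_HDprime_le` at the smallest
parameter, transported by `Dprime_eq_of_le`. [cite: Balaban1985RegularSpaces, Proposition 5 (1.107)–(1.109) p.94;
p.97 (last paragraph of Sect. E); inputs (1.99)–(1.103) p.93, (1.92) pp.91–92, (1.121) p.96, (1.125) p.97] -/
theorem propFive_constructed (G' : Gm →L[ℂ] E) (g₀ : Gm) (Φ : E → Gm) (Sol : E → Prop)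
    (C' : E → Xc) (H' : Xc →L[ℝ] E) {B₀' B₁ C₄' C₂' s ρ α₃ α : ℝ}
    (hB₀ : 0 < B₀') (hB₁ : 0 < B₁) (hs : 0 < s) (hC₂ : 0 < C₂') (h3 : 0 ≤ α₃)
    (hG : ‖G'‖ ≤ B₀') (hg₀ : ‖g₀‖ ≤ B₁ * s) (hH : ‖H'‖ ≤ B₀') (hαmin : 8 * B₀' * B₁ * s ≤ α)
    (hΦd : DifferentiableOn ℂ Φ (ball (0 : E) (α / 2)))
    (h99max : ∀ lam ∈ ball (0 : E) (α / 2), ‖Φ lam‖ ≤ C₄' * (B₁ * s + ρ) * α)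
    (h99min : ∀ lam ∈ ball (0 : E) (8 * B₀' * B₁ * s / 2),
      ‖Φ lam‖ ≤ C₄' * (B₁ * s + ρ) * (8 * B₀' * B₁ * s))
    (hsmall : 8 * B₀' * C₄' * (B₁ * s + ρ) ≤ 1)
    (h121 : ∀ μ : E, ‖μ‖ < α → ‖C' μ‖ < C₂' * (α₃ + α) * α)
    (h125 : ∀ μ₁ μ₂ : E, ‖μ₁‖ < α → ‖μ₂‖ < α → ‖C' μ₁ - C' μ₂‖ ≤ 2 * C₂' * (α₃ + α) * ‖μ₁ - μ₂‖)
    (h121s : ∀ μ : E, ‖μ‖ < 8 * B₀' * B₁ * s →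
      ‖C' μ‖ < C₂' * (α₃ + 8 * B₀' * B₁ * s) * (8 * B₀' * B₁ * s))
    (h125s : ∀ μ₁ μ₂ : E, ‖μ₁‖ < 8 * B₀' * B₁ * s → ‖μ₂‖ < 8 * B₀' * B₁ * s →
      ‖C' μ₁ - C' μ₂‖ ≤ 2 * C₂' * (α₃ + 8 * B₀' * B₁ * s) * ‖μ₁ - μ₂‖)
    (hsm : α₃ + α ≤ 1 / (8 * B₀' * C₂'))
    (hSolOfFix : ∀ lam : E, ‖lam‖ ≤ 2 * B₀' * B₁ * s → G' (g₀ + Φ lam) = lam →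
      Sol (lam - H' (Dprime C' H' (α / (2 * B₀')) lam)))
    (hFixOfSol : ∀ lam : E, ‖lam‖ < α / 2 → Sol (lam - H' (Dprime C' H' (α / (2 * B₀')) lam)) →
      G' (g₀ + Φ lam) = lam) :
    ∃ lamStar : E, ‖lamStar‖ ≤ 2 * B₀' * B₁ * s ∧ G' (g₀ + Φ lamStar) = lamStar ∧
      Sol (lamStar - H' (Dprime C' H' (α / (2 * B₀')) lamStar)) ∧
      ‖lamStar - H' (Dprime C' H' (α / (2 * B₀')) lamStar)‖ ≤ 3 * B₀' * B₁ * s ∧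
      ∀ mu : E, ‖mu‖ < α / 4 → Sol mu → mu = lamStar - H' (Dprime C' H' (α / (2 * B₀')) lamStar) := by
  have hp : 0 < B₀' * B₁ * s := by positivity
  have haS : 0 < 8 * B₀' * B₁ * s := by positivity
  have hαpos : 0 < α := lt_of_lt_of_le haS hαmin
  -- existence at the smallest parameter α₄ = 8B′₀B₁s (p. 94)
  have hΦd' : DifferentiableOn ℂ Φ (ball (0 : E) (8 * B₀' * B₁ * s / 2)) :=
    hΦd.mono (ball_subset_ball (by linarith))
  obtain ⟨hex, -, -⟩ := propFive_repaired_choice G' g₀ Φ hB₀ hB₁ hs hG hg₀ hΦd' h99min hsmall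
  obtain ⟨lamStar, ⟨hnorm, hfix⟩, -⟩ := hex
  -- uniqueness of the fixed point at the largest parameter α
  have hMα : 8 * B₀' * (C₄' * (B₁ * s + ρ) * α) ≤ α := by
    have e : 8 * B₀' * (C₄' * (B₁ * s + ρ) * α) = (8 * B₀' * C₄' * (B₁ * s + ρ)) * α := by ring
    rw [e]
    exact mul_le_of_le_one_left hαpos.le hsmall
  have hm₀α : 8 * B₀' * (B₁ * s) ≤ α := by linarith
  obtain ⟨himgα, hqα, -, -, hexα, -⟩ :=
    fixedPoint_of_sup_bound G' g₀ Φ hαpos hG hg₀ hΦd h99max hMα hm₀α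
  have himg : ∀ lam : E, ‖lam‖ < α / 2 → ‖G' (g₀ + Φ lam)‖ ≤ α / 4 := fun lam h =>
    (himgα lam (mem_ball_zero_iff.2 h)).trans hqα
  have huniq := eq_of_existsUnique_fixedPoint (fun lam => G' (g₀ + Φ lam)) hexα
  -- the p. 97 onto sentence for the CONSTRUCTED D′ (v1 of this file), at the largest parameter
  have honto := linMap_onto_quarter' C' H' hB₀ hC₂ h3 hαpos hH h121 h125 hsm
  have hstar : ‖lamStar‖ ≤ α / 4 := by linarith
  have hall := sol_eq_image_of_onto (fun lam => G' (g₀ + Φ lam))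
    (fun lam => lam - H' (Dprime C' H' (α / (2 * B₀')) lam)) Sol himg huniq honto hFixOfSol hstar hfix
  -- the bound (1.108): ‖H′D′λ⋆‖ at the smallest parameter, transported by radius-independence of D′
  have hsm4 : α₃ + α ≤ 1 / (4 * B₀' * C₂') := smallness_quarter_of_eighth hB₀ hC₂ hsm
  have hsmS : α₃ + 8 * B₀' * B₁ * s ≤ 1 / (8 * B₀' * C₂') := by linarith
  have hlamS : ‖lamStar‖ < 8 * B₀' * B₁ * s / 2 := by linarith
  have hDeq : Dprime C' H' (α / (2 * B₀')) lamStar = Dprime C' H' (8 * B₀' * B₁ * s / (2 * B₀')) lamStar :=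
    Dprime_eq_of_le C' H' hB₀ hC₂ h3 hαpos haS hαmin hH h121 h125 hsm4 h121s h125s hlamS
  have hHD : ‖H' (Dprime C' H' (8 * B₀' * B₁ * s / (2 * B₀')) lamStar)‖ ≤ 8 * B₀' * B₁ * s / 8 :=
    norm_HDprime_le C' H' hB₀ hC₂ h3 haS hH h121s h125s hsmS hlamS
  refine ⟨lamStar, hnorm, hfix, hSolOfFix lamStar hnorm hfix, ?_, hall⟩
  calc ‖lamStar - H' (Dprime C' H' (α / (2 * B₀')) lamStar)‖
      ≤ ‖lamStar‖ + ‖H' (Dprime C' H' (α / (2 * B₀')) lamStar)‖ := norm_sub_le _ _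
    _ = ‖lamStar‖ + ‖H' (Dprime C' H' (8 * B₀' * B₁ * s / (2 * B₀')) lamStar)‖ := by rw [hDeq]
    _ ≤ 2 * B₀' * B₁ * s + 8 * B₀' * B₁ * s / 8 := add_le_add hnorm hHD
    _ = 3 * B₀' * B₁ * s := by ring

/-- **Proposition 5 in the printed shape, with the constructed `D′`** (cf. `B8Prop5Repaired.propFive_printed_shape`,
whose hypotheses `hFlip`/`hFsmall`/`hFmin`/`hφ` on the Sect. E map are no longer needed): under the inputs of
`propFive_constructed` and `32B′₀B₁s ≤ α` (so that `8B′₀B₁s ≤ ¼α = c₃`), there is a solution `μ` of (1.107) with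
`‖μ‖ < 8B′₀B₁(α₀+α₁)` ((1.108); indeed `≤ 3B′₀B₁(α₀+α₁)`), there is EXACTLY ONE solution with `‖μ‖ < ¼α` ((1.109),
`c₃ = ¼α` independent of `α₀ + α₁`), and `8B′₀B₁s ≤ ¼α`. [cite: Balaban1985RegularSpaces, Proposition 5
(1.107)–(1.109) p.94; p.97 (last paragraph of Sect. E)] -/
theorem propFive_constructed_printed_shape (G' : Gm →L[ℂ] E) (g₀ : Gm) (Φ : E → Gm) (Sol : E → Prop)
    (C' : E → Xc) (H' : Xc →L[ℝ] E) {B₀' B₁ C₄' C₂' s ρ α₃ α : ℝ}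
    (hB₀ : 0 < B₀') (hB₁ : 0 < B₁) (hs : 0 < s) (hC₂ : 0 < C₂') (h3 : 0 ≤ α₃)
    (hG : ‖G'‖ ≤ B₀') (hg₀ : ‖g₀‖ ≤ B₁ * s) (hH : ‖H'‖ ≤ B₀') (h32 : 32 * B₀' * B₁ * s ≤ α)
    (hΦd : DifferentiableOn ℂ Φ (ball (0 : E) (α / 2)))
    (h99max : ∀ lam ∈ ball (0 : E) (α / 2), ‖Φ lam‖ ≤ C₄' * (B₁ * s + ρ) * α)
    (h99min : ∀ lam ∈ ball (0 : E) (8 * B₀' * B₁ * s / 2),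
      ‖Φ lam‖ ≤ C₄' * (B₁ * s + ρ) * (8 * B₀' * B₁ * s))
    (hsmall : 8 * B₀' * C₄' * (B₁ * s + ρ) ≤ 1)
    (h121 : ∀ μ : E, ‖μ‖ < α → ‖C' μ‖ < C₂' * (α₃ + α) * α)
    (h125 : ∀ μ₁ μ₂ : E, ‖μ₁‖ < α → ‖μ₂‖ < α → ‖C' μ₁ - C' μ₂‖ ≤ 2 * C₂' * (α₃ + α) * ‖μ₁ - μ₂‖)
    (h121s : ∀ μ : E, ‖μ‖ < 8 * B₀' * B₁ * s →
      ‖C' μ‖ < C₂' * (α₃ + 8 * B₀' * B₁ * s) * (8 * B₀' * B₁ * s))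
    (h125s : ∀ μ₁ μ₂ : E, ‖μ₁‖ < 8 * B₀' * B₁ * s → ‖μ₂‖ < 8 * B₀' * B₁ * s →
      ‖C' μ₁ - C' μ₂‖ ≤ 2 * C₂' * (α₃ + 8 * B₀' * B₁ * s) * ‖μ₁ - μ₂‖)
    (hsm : α₃ + α ≤ 1 / (8 * B₀' * C₂'))
    (hSolOfFix : ∀ lam : E, ‖lam‖ ≤ 2 * B₀' * B₁ * s → G' (g₀ + Φ lam) = lam →
      Sol (lam - H' (Dprime C' H' (α / (2 * B₀')) lam)))
    (hFixOfSol : ∀ lam : E, ‖lam‖ < α / 2 → Sol (lam - H' (Dprime C' H' (α / (2 * B₀')) lam)) →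
      G' (g₀ + Φ lam) = lam) :
    (∃ mu : E, Sol mu ∧ ‖mu‖ ≤ 3 * B₀' * B₁ * s ∧ ‖mu‖ < 8 * B₀' * B₁ * s) ∧
    (∃! mu : E, ‖mu‖ < α / 4 ∧ Sol mu) ∧
    8 * B₀' * B₁ * s ≤ α / 4 := by
  have hp : 0 < B₀' * B₁ * s := by positivity
  have hαmin : 8 * B₀' * B₁ * s ≤ α := by linarith
  obtain ⟨lamStar, hnorm, -, hsol, hbd, hall⟩ := propFive_constructed G' g₀ Φ Sol C' H' hB₀ hB₁ hs hC₂ h3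
    hG hg₀ hH hαmin hΦd h99max h99min hsmall h121 h125 h121s h125s hsm hSolOfFix hFixOfSol
  have hc₃ : 8 * B₀' * B₁ * s ≤ α / 4 := by linarith
  refine ⟨⟨_, hsol, hbd, by linarith⟩, ?_, hc₃⟩
  exact ⟨_, ⟨by linarith, hsol⟩, fun mu hmu => hall mu hmu.1 hmu.2⟩

end PropFiveConstructed

end Literature.MathematicalPhysics.QuantumFieldTheory.Balaban1983to89.B8Claim97OntoProof
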